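/-
Copyright: statement-level skeleton of a published paper (lit-balaban cell, Phase-2 proof seat p13, gen 6). No proof
claims beyond what the kernel checks below.
-/
import Literature.MathematicalPhysics.QuantumFieldTheory.BalabanImbrieJaffe1984to88.BIJ88CsClusters306
import Literature.MathematicalPhysics.QuantumFieldTheory.Balaban1983to89.B2Eq228Conditioning

/-!
# `BalabanImbrieJaffe1984to88.BIJ88ClusterFactorization306` — T. Bałaban, J. Imbrie, A. Jaffe, *Effective action and
cluster properties of the abelian Higgs model*, Commun. Math. Phys. **114** (1988) 257–315 [BalabanImbrieJaffe1988],
§5.13 p. 306 [PDF 50]: **"Thus our expression … factorizes over the connected components of Γ. … The expression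
also factorizes over the □_{i′}, i′ ∈ I∖Γ. Call the factorization regions clusters."** — PROVED AT THE LEVEL OF THE
GAUSSIAN INTEGRAL: when the inverse covariance does not couple a union `U` of clusters to its complement (the cluster
structure of the interpolated form `Δ_s`, `…BIJ88CsClusters306`), the Gaussian integral — weight `e^{−½⟨Φ,AΦ⟩}` WITH
the linear term `e^{⟨ℱ,Φ⟩}` of p. 305 — of a product of a `U`-local and a `Uᶜ`-local observable IS THE PRODUCT of the
two marginal integrals (Fubini over `Φ = (Φ↾_U, Φ↾_{Uᶜ})`).

statement-level skeleton of published theorems with citation tags; proofs where landed; nothing here is a claim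
about the Yang–Mills mass gap

PDF held: `paper:balaban1988-cmp114-bij-abelian-higgs-effective-action` (journal page = PDF page + 256; pp. 305–306
read with `lit read … --pages 49-50`).

CITATION HEADER (lean-in-tree rule).  lit-balaban cell (HOME `run/shared/lean/pub/lit-balaban/`), Phase 2, seat p13
gen 6 (unit `lit-balaban-p13-g6`); third file of the p. 305–306 group after `…BIJ88CsDecay305` (p254974: `C_s` exists and
decays) and `…BIJ88CsClusters306` (p255115: `Δ_s`, `C_s` are cluster-block-diagonal); row **C2.Eq5.13.3-5.13.4** of
`HOME/lit-balaban-r16/ROWS-C2-part2.md` (owner r16, referee ref-5), the p. 306 member «factorizes over the connected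
components of Γ / over the □_{i′}, i′ ∈ I∖Γ».  Files USED BY NAME, nothing restated: `…Balaban1983to89.B2Eq228Conditioning`
(`In`, `Out`, `resIn`, `resOut`, `glue`, `blkIn`, `blkOut`, `blkMix`, `blkMix'`, `weight`, `source`, `quadForm_glue`,
`linForm_glue`, `integral_eq_integral_glue` — the Fubini splitting `(S → ℝ) ≃ᵐ (U → ℝ) × (Uᶜ → ℝ)`),
`…BIJ88DirichletForms305` (`interpForm`), `…BIJ88CsClusters306` (`interpForm_blockDiag`, `interpForm_apply_eq_zero`);
Mathlib (`MeasureTheory.integral_prod_mul`).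

## The print (verbatim, p. 305–306)

p. 305: *"Recall that we have a linear term in the measure, e^{⟨Φ,ℱ⟩}."*  p. 306: *"Let us examine the factorization
properties of this expansion. The form Δ has a range less than ½r(e_k). The f(□_i) do not couple different □_i. Hence
only adjacent □_j with s_j ≠ 0 interact in the above formula. Thus our expression for ∂/∂s_Γ ⟨Π_{i∈I} f(□_i)⟩_{s_Γ}
factorizes over the connected components of Γ. (Here we say that □_i is connected to □_{i′} if they abut on a
hypersurface of any dimension.) The expression also factorizes over the □_{i′}, i′ ∈ I∖Γ. Call the factorization
regions clusters. … ⟨ ⟩_{s_Γ,X} is defined by integrating over the fields in X only."*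

## What is proved (0 `sorry`, standard axioms, theorems only, no new `def`)

Variables `Φ : S → ℝ` on a finite index type `S`, a decidable predicate `p` (membership in the union `U` of clusters),
the splitting `Φ = (x on U, y on Uᶜ)` of `B2Eq228Conditioning` (`glue p x y`), precision matrix `A` (the printed `−Δ_s`)
and linear term `ℱ = f`; "A does not couple `U` to `Uᶜ`" is the displayed pair of hypotheses `hA : p s → ¬p t →
A s t = 0`, `hA′ : ¬p s → p t → A s t = 0`.
* §1 THE SPLITTING OF THE WEIGHT: `e^{−½⟨Φ,AΦ⟩}e^{⟨f,Φ⟩} = (e^{−½⟨x,A_Ux⟩}e^{⟨f↾U,x⟩})·(e^{−½⟨y,A_{Uᶜ}y⟩}e^{⟨f↾Uᶜ,y⟩})`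
  (`weight_mul_source_glue_of_blockDiag`; the mixed blocks vanish, `blkMix_eq_zero`/`blkMix'_eq_zero`).
* §2 **THE FACTORIZATION** (`integral_factorizes`): for ALL `F : (U → ℝ) → ℝ`, `G : (Uᶜ → ℝ) → ℝ`,
  `∫dΦ F(Φ↾U)G(Φ↾Uᶜ)e^{−½⟨Φ,AΦ⟩}e^{⟨f,Φ⟩} = (∫dx F(x)e^{−½⟨x,A_Ux⟩}e^{⟨f↾U,x⟩})·(∫dy G(y)e^{−½⟨y,A_{Uᶜ}y⟩}e^{⟨f↾Uᶜ,y⟩})`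
  (Fubini, `integral_eq_integral_glue` + Mathlib's `integral_prod_mul`; no integrability hypothesis is needed for this
  product form); hence the partition function factorizes (`partition_factorizes`), NORMALIZED expectations factorize
  (`expectation_factorizes`), and the expectation of a `U`-local observable is its expectation in the `U`-marginal —
  *"⟨ ⟩_{s_Γ,X} is defined by integrating over the fields in X only"* (`expectation_local`).
* §3 THE TWO PRINTED INSTANCES for the interpolated form `Δ_s = interpForm blk Δ s` of p. 305 (precision `A := Δ_s`;
  feed `Δ := −Δ_print`): (a) *"factorizes over the connected components"*: `U` = any union of clusters of a cluster
  labelling `cls` (constant on interacting pairs; Δ coupling only abutting regions — `interpForm_blockDiag`):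
  `integral_factorizes_clusters`; (b) *"also factorizes over the □_{i′}, i′ ∈ I∖Γ"*: `U = □_{i′}` with `s_{i′} = 0`, no
  range hypothesis: `integral_factorizes_region`.
* §4 (v1.1) *"only clusters intersecting Λ^{(k)c}_{11} have any dependence on … ℱ, Δ^{(k)} − Δ^{(k)}_1 … nonzero only in
  Λ^{(k)c}_{11}"*: a `U`-local expectation sees neither a linear term vanishing on `U` nor the precision outside `U × U`
  (`source_resIn_eq_one`, `blkIn_eq_of_agree`, `expectation_local_indep`, `integral_factorizes_indep`).
HONEST SCOPE.  Finite-dimensional Lebesgue/Gaussian integrals with real fields, as in `B2Eq228Conditioning`; the printed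
measure also carries the characteristic functions and the `f(□_i)`, which are `□_i`-local and are absorbed in `F`, `G`
here; the s-derivatives, (5.13.3)–(5.13.4) and the polymer activities are NOT modelled.  The full product over all
clusters follows by iterating the two-sided statement (not spelled out).  NOT summit progress; NOT continuum; NOT Clay.
Imports: `BIJ88CsClusters306` + `Balaban1983to89.B2Eq228Conditioning`; modifies nothing.
-/

namespace Literature.MathematicalPhysics.QuantumFieldTheory.BalabanImbrieJaffe1984to88.BIJ88ClusterFactorization306

open MeasureTheory Matrix Finset
open scoped BigOperators
open Literature.MathematicalPhysics.QuantumFieldTheory.Balaban1983to89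
open B2Eq228Conditioning (In Out resIn resOut glue blkIn blkOut blkMix blkMix' weight source)
open BIJ88DirichletForms305 hiding weight sum_weight weight_nonneg
open BIJ88CsClusters306

/-! ## §1  The weight splits when `A` does not couple `U` to `Uᶜ` -/

section TwoBlocks

variable {S : Type} [Fintype S] (p : S → Prop) [DecidablePred p]

omit [Fintype S] [DecidablePred p] in
/-- No coupling `U → Uᶜ`: the mixed block `A_{U,Uᶜ}` vanishes. [cite: BalabanImbrieJaffe1988, §5.13 p.306] -/
theorem blkMix_eq_zero {A : Matrix S S ℝ} (hA : ∀ s t, p s → ¬ p t → A s t = 0) : blkMix p A = 0 := by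
  ext i j
  exact hA i.1 j.1 i.2 j.2

omit [Fintype S] [DecidablePred p] in
/-- No coupling `Uᶜ → U`: the mixed block `A_{Uᶜ,U}` vanishes. [cite: BalabanImbrieJaffe1988, §5.13 p.306] -/
theorem blkMix'_eq_zero {A : Matrix S S ℝ} (hA' : ∀ s t, ¬ p s → p t → A s t = 0) : blkMix' p A = 0 := by
  ext j i
  exact hA' j.1 i.1 j.2 i.2

/-- **The Gaussian weight with linear term splits**: for `Φ = (x on U, y on Uᶜ)` and `A` not coupling `U` to `Uᶜ`,
`e^{−½⟨Φ,AΦ⟩}e^{⟨f,Φ⟩} = (e^{−½⟨x,A_Ux⟩}e^{⟨f↾U,x⟩})(e^{−½⟨y,A_{Uᶜ}y⟩}e^{⟨f↾Uᶜ,y⟩})`.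
[cite: BalabanImbrieJaffe1988, §5.13 p.306] -/
theorem weight_mul_source_glue_of_blockDiag {A : Matrix S S ℝ} (hA : ∀ s t, p s → ¬ p t → A s t = 0)
    (hA' : ∀ s t, ¬ p s → p t → A s t = 0) (f : S → ℝ) (x : In p → ℝ) (y : Out p → ℝ) :
    weight A (glue p x y) * source f (glue p x y)
      = (weight (blkIn p A) x * source (resIn p f) x) * (weight (blkOut p A) y * source (resOut p f) y) := by
  simp only [B2Eq228Conditioning.weight, B2Eq228Conditioning.source]
  rw [B2Eq228Conditioning.quadForm_glue, B2Eq228Conditioning.linForm_glue, blkMix_eq_zero p hA,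
    blkMix'_eq_zero p hA']
  simp only [Matrix.zero_mulVec, dotProduct_zero, add_zero]
  rw [← Real.exp_add, ← Real.exp_add, ← Real.exp_add, ← Real.exp_add]
  congr 1
  simp only [dotProduct]
  ring

/-! ## §2  The factorization of the Gaussian integral -/

/-- **FACTORIZATION OVER CLUSTERS** (two-sided form): if the precision `A` does not couple `U` to `Uᶜ`, then for every
`U`-local `F` and `Uᶜ`-local `G`,
`∫dΦ F(Φ↾U)G(Φ↾Uᶜ)e^{−½⟨Φ,AΦ⟩}e^{⟨f,Φ⟩} = (∫dx F e^{−½⟨x,A_Ux⟩}e^{⟨f↾U,x⟩})(∫dy G e^{−½⟨y,A_{Uᶜ}y⟩}e^{⟨f↾Uᶜ,y⟩})`.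
[cite: BalabanImbrieJaffe1988, §5.13 p.306] -/
theorem integral_factorizes {A : Matrix S S ℝ} (hA : ∀ s t, p s → ¬ p t → A s t = 0)
    (hA' : ∀ s t, ¬ p s → p t → A s t = 0) (f : S → ℝ) (F : (In p → ℝ) → ℝ) (G : (Out p → ℝ) → ℝ) :
    ∫ φ, F (resIn p φ) * G (resOut p φ) * (weight A φ * source f φ)
      = (∫ x, F x * (weight (blkIn p A) x * source (resIn p f) x))
        * (∫ y, G y * (weight (blkOut p A) y * source (resOut p f) y)) := by
  rw [B2Eq228Conditioning.integral_eq_integral_glue p]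
  simp only [B2Eq228Conditioning.resIn_glue, B2Eq228Conditioning.resOut_glue,
    weight_mul_source_glue_of_blockDiag p hA hA' f]
  rw [MeasureTheory.Measure.volume_eq_prod, ← MeasureTheory.integral_prod_mul]
  refine integral_congr_ae (Filter.Eventually.of_forall fun q => ?_)
  ring

/-- The partition function factorizes: `Z = Z_U · Z_{Uᶜ}`. [cite: BalabanImbrieJaffe1988, §5.13 p.306] -/
theorem partition_factorizes {A : Matrix S S ℝ} (hA : ∀ s t, p s → ¬ p t → A s t = 0)
    (hA' : ∀ s t, ¬ p s → p t → A s t = 0) (f : S → ℝ) :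
    ∫ φ, weight A φ * source f φ
      = (∫ x, weight (blkIn p A) x * source (resIn p f) x) * (∫ y, weight (blkOut p A) y * source (resOut p f) y) := by
  have h := integral_factorizes p hA hA' f (fun _ => 1) (fun _ => 1)
  simpa only [one_mul] using h

/-- **Normalized expectations factorize**: `⟨F(Φ↾U)G(Φ↾Uᶜ)⟩ = ⟨F⟩_U ⟨G⟩_{Uᶜ}` (marginal expectations), whenever the two
marginal partition functions are nonzero (positive definite blocks; with Lean's `x/0 = 0` the identity holds even
without that proviso). [cite: BalabanImbrieJaffe1988, §5.13 p.306] -/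
theorem expectation_factorizes {A : Matrix S S ℝ} (hA : ∀ s t, p s → ¬ p t → A s t = 0)
    (hA' : ∀ s t, ¬ p s → p t → A s t = 0) (f : S → ℝ) (F : (In p → ℝ) → ℝ) (G : (Out p → ℝ) → ℝ) :
    (∫ φ, F (resIn p φ) * G (resOut p φ) * (weight A φ * source f φ)) / (∫ φ, weight A φ * source f φ)
      = ((∫ x, F x * (weight (blkIn p A) x * source (resIn p f) x))
            / (∫ x, weight (blkIn p A) x * source (resIn p f) x))
        * ((∫ y, G y * (weight (blkOut p A) y * source (resOut p f) y))
            / (∫ y, weight (blkOut p A) y * source (resOut p f) y)) := by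
  rw [integral_factorizes p hA hA', partition_factorizes p hA hA', mul_div_mul_comm]

/-- **A `U`-local observable is integrated in the `U`-marginal** — *"⟨ ⟩_{s_Γ,X} is defined by integrating over the
fields in X only"*: `⟨F(Φ↾U)⟩ = ⟨F⟩_U` when the `Uᶜ` partition function is nonzero. [cite: BalabanImbrieJaffe1988, §5.13 p.306] -/
theorem expectation_local {A : Matrix S S ℝ} (hA : ∀ s t, p s → ¬ p t → A s t = 0)
    (hA' : ∀ s t, ¬ p s → p t → A s t = 0) (f : S → ℝ) (F : (In p → ℝ) → ℝ)
    (hZ₂ : ∫ y, weight (blkOut p A) y * source (resOut p f) y ≠ 0) :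
    (∫ φ, F (resIn p φ) * (weight A φ * source f φ)) / (∫ φ, weight A φ * source f φ)
      = (∫ x, F x * (weight (blkIn p A) x * source (resIn p f) x))
          / (∫ x, weight (blkIn p A) x * source (resIn p f) x) := by
  have h := integral_factorizes p hA hA' f F (fun _ => 1)
  simp only [mul_one, one_mul] at h
  rw [h, partition_factorizes p hA hA', mul_div_mul_right _ _ hZ₂]

end TwoBlocks

/-! ## §3  The two printed instances for the interpolated form `Δ_s` -/

section Interpolated

variable {α I : Type} [Fintype α] [DecidableEq α] [DecidableEq I] [Fintype I] (blk : α → I)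

/-- **(a) *"factorizes over the connected components"***: with `Δ` coupling only abutting regions (`hΔ`), a cluster
labelling `cls` constant on interacting pairs (`hcls`), and `U` = the union of the clusters selected by a predicate `P`
on cluster labels, the Gaussian integral with precision `Δ_s` and linear term `f` of `F(Φ↾U)G(Φ↾Uᶜ)` is the product of
the marginal integrals. [cite: BalabanImbrieJaffe1988, §5.13 p.306] -/
theorem integral_factorizes_clusters {K : Type*} (Δ : Matrix α α ℝ) (s : I → ℝ) (adj : I → I → Prop)
    (hΔ : ∀ x y, blk x ≠ blk y → ¬ adj (blk x) (blk y) → Δ x y = 0) (cls : I → K)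
    (hcls : ∀ i j, i ≠ j → s i ≠ 0 → s j ≠ 0 → adj i j → cls i = cls j) (P : K → Prop) [DecidablePred P]
    (f : α → ℝ) (F : (In (fun x => P (cls (blk x))) → ℝ) → ℝ) (G : (Out (fun x => P (cls (blk x))) → ℝ) → ℝ) :
    ∫ φ, F (resIn (fun x => P (cls (blk x))) φ) * G (resOut (fun x => P (cls (blk x))) φ)
        * (weight (interpForm blk Δ s) φ * source f φ)
      = (∫ x, F x * (weight (blkIn (fun x => P (cls (blk x))) (interpForm blk Δ s)) x
            * source (resIn (fun x => P (cls (blk x))) f) x))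
        * (∫ y, G y * (weight (blkOut (fun x => P (cls (blk x))) (interpForm blk Δ s)) y
            * source (resOut (fun x => P (cls (blk x))) f) y)) := by
  refine integral_factorizes (fun x => P (cls (blk x))) (fun x y hx hy => ?_) (fun x y hx hy => ?_) f F G
  · exact interpForm_blockDiag blk Δ s adj hΔ cls hcls (fun h => hy (h ▸ hx))
  · exact interpForm_blockDiag blk Δ s adj hΔ cls hcls (fun h => hx (h ▸ hy))

/-- **(b) *"The expression also factorizes over the □_{i′}, i′ ∈ I∖Γ"***: a region `□_{i′}` with `s_{i′} = 0` (`s_Γ`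
vanishes off `Γ`) decouples from everything — no range hypothesis: the Gaussian integral with precision `Δ_s` and
linear term `f` of `F(Φ↾□_{i′})G(Φ↾□_{i′}ᶜ)` is the product of the marginal integrals. [cite: BalabanImbrieJaffe1988, §5.13 p.306] -/
theorem integral_factorizes_region (Δ : Matrix α α ℝ) (s : I → ℝ) (i₀ : I) (h0 : s i₀ = 0) (f : α → ℝ)
    (F : (In (fun x => blk x = i₀) → ℝ) → ℝ) (G : (Out (fun x => blk x = i₀) → ℝ) → ℝ) :
    ∫ φ, F (resIn (fun x => blk x = i₀) φ) * G (resOut (fun x => blk x = i₀) φ)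
        * (weight (interpForm blk Δ s) φ * source f φ)
      = (∫ x, F x * (weight (blkIn (fun x => blk x = i₀) (interpForm blk Δ s)) x
            * source (resIn (fun x => blk x = i₀) f) x))
        * (∫ y, G y * (weight (blkOut (fun x => blk x = i₀) (interpForm blk Δ s)) y
            * source (resOut (fun x => blk x = i₀) f) y)) := by
  refine integral_factorizes (fun x => blk x = i₀) (fun x y hx hy => ?_) (fun x y hx hy => ?_) f F G
  · exact interpForm_apply_eq_zero blk Δ s (fun h => hy (h ▸ hx)) (Or.inl (hx ▸ h0))
  · exact interpForm_apply_eq_zero blk Δ s (fun h => hx (h ▸ hy)) (Or.inr (Or.inl (hy ▸ h0)))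

end Interpolated

/-! ## §4  (v1.1) "only clusters intersecting Λ^{(k)c}_{11} have any dependence on … ℱ, Δ^{(k)} − Δ^{(k)}_1 …"

p. 306, verbatim: *"It is worth mentioning here that only clusters intersecting Λ^{(k)c}_{11} have any dependence on
Λ^{(k)}_9, φ^{(k)}, A^{(k)}, Q_c^*A^{(k)}. This is because ℱ, Δ^{(k)} − Δ^{(k)}_1, φ^{(k)} − φ^{(k)′} are nonzero only in
Λ^{(k)c}_{11}. Thus we have finally decoupled clusters that do not intersect Λ^{(k)c}_{11} from the large field regions"* —
PROVED at the level of the Gaussian integral: a `U`-local expectation sees neither a linear term `ℱ` vanishing on `U` nor the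
entries of the precision matrix outside `U × U`. -/

section Independence

variable {S : Type} [Fintype S] (p : S → Prop) [DecidablePred p]

/-- If the linear term vanishes on `U` (*"ℱ … nonzero only in Λ^{(k)c}_{11}"*), the `U`-marginal carries no source:
`e^{⟨ℱ↾U, x⟩} = 1`. [cite: BalabanImbrieJaffe1988, §5.13 p.306] -/
theorem source_resIn_eq_one {f : S → ℝ} (hf : ∀ s, p s → f s = 0) (x : In p → ℝ) : source (resIn p f) x = 1 := by
  simp only [B2Eq228Conditioning.source, B2Eq228Conditioning.resIn]
  rw [Finset.sum_eq_zero (fun i _ => by rw [hf i.1 i.2, zero_mul]), Real.exp_zero]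

omit [Fintype S] [DecidablePred p] in
/-- If two precision matrices agree on `U × U` (*"Δ^{(k)} − Δ^{(k)}_1 … nonzero only in Λ^{(k)c}_{11}"*), their
`U`-blocks coincide. [cite: BalabanImbrieJaffe1988, §5.13 p.306] -/
theorem blkIn_eq_of_agree {A A' : Matrix S S ℝ} (h : ∀ s t, p s → p t → A s t = A' s t) :
    blkIn p A = blkIn p A' := by
  ext i j
  exact h i.1 j.1 i.2 j.2

/-- **"only clusters intersecting Λ^{(k)c}_{11} have any dependence on … ℱ, Δ^{(k)} − Δ^{(k)}_1 …"**: if the precision `A`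
does not couple `U` to `Uᶜ`, agrees with `A'` on `U × U`, and the linear term `ℱ` vanishes on `U`, then the expectation
of a `U`-local observable in the full measure `e^{−½⟨Φ,AΦ⟩}e^{⟨ℱ,Φ⟩}dΦ` is its expectation in the SOURCE-FREE
`U`-marginal of `A'` — `⟨F(Φ↾U)⟩_{A,ℱ} = ∫F(x)e^{−½⟨x,A'_Ux⟩}dx / ∫e^{−½⟨x,A'_Ux⟩}dx` — no dependence on `ℱ` nor on
the entries of `A` outside `U × U` (*"decoupled … from the large field regions"*), whenever the `Uᶜ` partition function
is nonzero. [cite: BalabanImbrieJaffe1988, §5.13 p.306] -/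
theorem expectation_local_indep {A A' : Matrix S S ℝ} (hA : ∀ s t, p s → ¬ p t → A s t = 0)
    (hA' : ∀ s t, ¬ p s → p t → A s t = 0) (hagree : ∀ s t, p s → p t → A s t = A' s t) {f : S → ℝ}
    (hf : ∀ s, p s → f s = 0) (F : (In p → ℝ) → ℝ)
    (hZ₂ : ∫ y, weight (blkOut p A) y * source (resOut p f) y ≠ 0) :
    (∫ φ, F (resIn p φ) * (weight A φ * source f φ)) / (∫ φ, weight A φ * source f φ)
      = (∫ x, F x * weight (blkIn p A') x) / (∫ x, weight (blkIn p A') x) := by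
  rw [expectation_local p hA hA' f F hZ₂, blkIn_eq_of_agree p hagree]
  simp only [source_resIn_eq_one p hf, mul_one]

/-- The same for the two-sided factorization: with `ℱ↾U = 0` and `A = A'` on `U × U`, the `U`-factor of
`integral_factorizes` is the source-free `A'_U`-integral. [cite: BalabanImbrieJaffe1988, §5.13 p.306] -/
theorem integral_factorizes_indep {A A' : Matrix S S ℝ} (hA : ∀ s t, p s → ¬ p t → A s t = 0)
    (hA' : ∀ s t, ¬ p s → p t → A s t = 0) (hagree : ∀ s t, p s → p t → A s t = A' s t) {f : S → ℝ}
    (hf : ∀ s, p s → f s = 0) (F : (In p → ℝ) → ℝ) (G : (Out p → ℝ) → ℝ) :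
    ∫ φ, F (resIn p φ) * G (resOut p φ) * (weight A φ * source f φ)
      = (∫ x, F x * weight (blkIn p A') x)
        * (∫ y, G y * (weight (blkOut p A) y * source (resOut p f) y)) := by
  rw [integral_factorizes p hA hA' f F G, blkIn_eq_of_agree p hagree]
  simp only [source_resIn_eq_one p hf, mul_one]

end Independence

end Literature.MathematicalPhysics.QuantumFieldTheory.BalabanImbrieJaffe1984to88.BIJ88ClusterFactorization306
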